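import Summits.ValiantsHypothesis.ValiantsHypothesis.Theorems.SymPencilPerFourInnerRankReducedFamily
import Summits.ValiantsHypothesis.ValiantsHypothesis.Theorems.SymPencilPerFourPeeledFrame

/-!
# Route `SymPencil` — inner rank of the `2 | 2` row split of `per_4`, PEELED case at `|κ| = 10`:
# the rank-four factorisation (`--supports` stmt-ValiantsHypothesis-5674 `SdcSuperquadratic`;
# (8,8) column, memo `NOTE-p6g16-5674-R2-peeled-ten.md` §2)

Glue between the reduced family (`…InnerRankReducedFamily.exists_reduced_family`: non-zero weights,
joint identity, scalar outer blocks `t'((a,0),(x,0)) = ψ(a,x) v₀`, `t'((0,b),(0,x)) = ψ'(b,x) v₀'`)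
and the abstract `…PeeledFrame.lagrangian_confinement`.

**Theorem** (`factor_of_peeled_ten`).  Let the reduced family have `|κ| = 10` and be PEELED
(the correction `Σ c t((a,0),(y,0)) t((0,b),(0,z))` is not identically zero).  Let `y₀, y₁` be two
parameters with `t((𝟙,0),(yᵢ,0)) = 0` (i.e. `ψ(𝟙,yᵢ) = 0`, `𝟙 = (1,1,1,1)`), such that the Hessian
matrix `P₀ = [per(𝟙;e_b;y₀;e_l)]` is invertible and the pencil `P₀⁻¹P₁`, `P₁ = [per(𝟙;e_b;y₁;e_l)]`,
has the Taussky–Zassenhaus property.  Then the flattening of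
`F'(a,b,y,z) := per(a;b;y;z) − 2 Σ c t((a,0),(y,0)) t((0,b),(0,z))` FACTORS THROUGH `K⁴`:
`F'(a,b,y,z) = Σ_{b'} (P₀⁻¹ (F'(𝟙,b,y,e_l))_l)_{b'} · F'(a,e_{b'},y₀,z)`.
(The contradiction with the flattening-rank lemma `rank ≥ 5`, memo §3, and the explicit pencil
witnesses, memo §2, are NOT in this file.)  Honest framing: conditional step; no cell closes;
`27 ≤ sdc(per_4) ≤ 29`, the crux and `VP ≠ VNP` are untouched.  No definitions, no named facts.
[folklore]
-/

noncomputable section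

-- single-conjunct layout: Sub = Summit, duplicated namespace component intended
set_option linter.dupNamespace false

namespace Summit.ValiantsHypothesis.ValiantsHypothesis.Theorems.SymPencilPerFourPeeledFactor

open Matrix Finset Module
open Summit.ValiantsHypothesis.ValiantsHypothesis.Theorems.SymPencilPerFourInnerRankRows
open Summit.ValiantsHypothesis.ValiantsHypothesis.Theorems.SymPencilPerFourInnerRankTenPairs
open Summit.ValiantsHypothesis.ValiantsHypothesis.Theorems.SymPencilPerFourInnerRankScalarBlock
open Summit.ValiantsHypothesis.ValiantsHypothesis.Theorems.SymPencilPerFourInnerRankReducedFamily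
open Summit.ValiantsHypothesis.ValiantsHypothesis.Theorems.SymPencilPerFourPeeledFrame

universe u v

variable {K : Type u} [Field K]

/-- **Rank-four factorisation in the peeled case at `|κ| = 10`.**  See the module docstring.
[folklore] -/
theorem factor_of_peeled_ten [CharZero K] {κ : Type v} [Fintype κ] [DecidableEq κ]
    (hκ : Fintype.card κ = 10) (c : κ → K) (hc : ∀ r, c r ≠ 0)
    (t : κ → (((Fin 4 → K) × (Fin 4 → K)) →ₗ[K] ((Fin 4 → K) × (Fin 4 → K)) →ₗ[K] K))
    (hJ : ∀ a b y₂ y₃ : Fin 4 → K,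
      ∑ r, c r * (t r (a, b) (y₂, y₃)) ^ 2 = (Matrix.of ![a, b, y₂, y₃]).permanent)
    (v₀ v₀' : κ → K) (hv₀ : ∀ (a x : Fin 4 → K), ∃ s : K, (fun r => t r (a, 0) (x, 0)) = s • v₀)
    (hv₀' : ∀ (b x : Fin 4 → K), ∃ s : K, (fun r => t r (0, b) (0, x)) = s • v₀')
    (hpeel : ∃ a b y z : Fin 4 → K, ∑ r, c r * t r (a, 0) (y, 0) * t r (0, b) (0, z) ≠ 0)
    (y₀ y₁ : Fin 4 → K) (hy₀ : ∀ r, t r ((fun _ => 1), 0) (y₀, 0) = 0)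
    (hy₁ : ∀ r, t r ((fun _ => 1), 0) (y₁, 0) = 0)
    (P₀ P₁ : Matrix (Fin 4) (Fin 4) K)
    (hP₀ : ∀ b l, P₀ b l =
      (Matrix.of ![(fun _ => (1 : K)), Pi.single b 1, y₀, Pi.single l 1]).permanent)
    (hP₁ : ∀ b l, P₁ b l =
      (Matrix.of ![(fun _ => (1 : K)), Pi.single b 1, y₁, Pi.single l 1]).permanent)
    (hdet : IsUnit P₀.det)
    (htz : ∀ A : Matrix (Fin 4) (Fin 4) K, Aᵀ = -A →
      A * (P₀⁻¹ * P₁) = (P₀⁻¹ * P₁)ᵀ * A → A = 0) :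
    ∀ a b y z : Fin 4 → K,
      (Matrix.of ![a, b, y, z]).permanent - 2 * ∑ r, c r * t r (a, 0) (y, 0) * t r (0, b) (0, z) =
        ∑ b', (P₀⁻¹ *ᵥ fun l => (Matrix.of ![(fun _ => (1 : K)), b, y, Pi.single l 1]).permanent
            - 2 * ∑ r, c r * t r ((fun _ => 1), 0) (y, 0) * t r (0, b) (0, Pi.single l 1)) b' *
          ((Matrix.of ![a, Pi.single b' 1, y₀, z]).permanent
            - 2 * ∑ r, c r * t r (a, 0) (y₀, 0) * t r (0, Pi.single b' 1) (0, z)) := by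
  classical
  -- 𝟙 and zero-vector bookkeeping
  set one : Fin 4 → K := fun _ => 1 with hone
  have t00 : ∀ r (p : (Fin 4 → K) × (Fin 4 → K)), t r ((0 : Fin 4 → K), (0 : Fin 4 → K)) p = 0 :=
    fun r p => by rw [show ((0 : Fin 4 → K), (0 : Fin 4 → K)) = (0 : (Fin 4 → K) × (Fin 4 → K))
      from rfl, map_zero, LinearMap.zero_apply]
  have t00' : ∀ r (p : (Fin 4 → K) × (Fin 4 → K)), t r p ((0 : Fin 4 → K), (0 : Fin 4 → K)) = 0 :=
    fun r p => by rw [show ((0 : Fin 4 → K), (0 : Fin 4 → K)) = (0 : (Fin 4 → K) × (Fin 4 → K))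
      from rfl, map_zero]
  -- the peeled hypothesis unpacked
  obtain ⟨a₁, b₁, yy, zz, hne⟩ := hpeel
  -- v₀ facts
  have hv0facts : (∑ r, c r * v₀ r ^ 2 = 0) ∧
      (∀ (a y : Fin 4 → K), ∑ r, c r * v₀ r * t r (a, 0) (0, y) = 0) ∧
      (∀ (b x : Fin 4 → K), ∑ r, c r * v₀ r * t r (0, b) (x, 0) = 0) := by
    rcases scalar_block_dichotomy c t hJ v₀ hv₀ with hz | h
    · exact absurd (Finset.sum_eq_zero fun r _ => by rw [hz a₁ yy r]; ring) hne
    · exact h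
  obtain ⟨hQ, hA₃, hB₂⟩ := hv0facts
  -- v₀' facts via the `a ↔ b`, `y₂ ↔ y₃` swapped design
  set tS : κ → (((Fin 4 → K) × (Fin 4 → K)) →ₗ[K] ((Fin 4 → K) × (Fin 4 → K)) →ₗ[K] K) :=
    fun r => ((t r).compl₁₂ (LinearEquiv.prodComm K (Fin 4 → K) (Fin 4 → K)).toLinearMap
      LinearMap.id).compl₂ (LinearEquiv.prodComm K (Fin 4 → K) (Fin 4 → K)).toLinearMap with htS
  have hJS : ∀ a b y₂ y₃ : Fin 4 → K,
      ∑ r, c r * (tS r (a, b) (y₂, y₃)) ^ 2 = (Matrix.of ![a, b, y₂, y₃]).permanent :=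
    hJ_yswap c _ (hJ_swap c t hJ)
  have htSap : ∀ r (a b y₂ y₃ : Fin 4 → K), tS r (a, b) (y₂, y₃) = t r (b, a) (y₃, y₂) :=
    fun r a b y₂ y₃ => by simp [htS]
  have hv0'facts : (∑ r, c r * v₀' r ^ 2 = 0) ∧
      (∀ (b y : Fin 4 → K), ∑ r, c r * v₀' r * t r (0, b) (y, 0) = 0) ∧
      (∀ (a x : Fin 4 → K), ∑ r, c r * v₀' r * t r (a, 0) (0, x) = 0) := by
    rcases scalar_block_dichotomy c tS hJS v₀' (fun b x => by
        obtain ⟨s, hs⟩ := hv₀' b x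
        exact ⟨s, by rw [← hs]; funext r; exact htSap r b 0 x 0⟩) with hz | ⟨h1, h2, h3⟩
    · refine absurd (Finset.sum_eq_zero fun r _ => ?_) hne
      have := hz b₁ zz r; rw [htSap] at this; rw [this]; ring
    · refine ⟨h1, fun b y => ?_, fun a x => ?_⟩
      · have := h2 b y; simpa only [htSap] using this
      · have := h3 a x; simpa only [htSap] using this
  obtain ⟨hQ', hB₂', hA₃'⟩ := hv0'facts
  -- ⟨v₀, v₀'⟩ ≠ 0
  have hlam : ∑ r, c r * v₀ r * v₀' r ≠ 0 := by
    obtain ⟨s, hs⟩ := hv₀ a₁ yy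
    obtain ⟨s', hs'⟩ := hv₀' b₁ zz
    have e1 : ∀ r, t r (a₁, 0) (yy, 0) = s * v₀ r := fun r => by
      have := congr_fun hs r; simpa using this
    have e2 : ∀ r, t r (0, b₁) (0, zz) = s' * v₀' r := fun r => by
      have := congr_fun hs' r; simpa using this
    intro h0
    apply hne
    have : ∑ r, c r * t r (a₁, 0) (yy, 0) * t r (0, b₁) (0, zz) =
        s * s' * ∑ r, c r * v₀ r * v₀' r := by
      rw [Finset.mul_sum]; exact Finset.sum_congr rfl fun r _ => by rw [e1, e2]; ring
    rw [this, h0, mul_zero]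
  -- the bilinear map ν(b,y) = t((0,b),(y,0)) and the frame vectors m_l = t((𝟙,0),(0,e_l))
  let ν : (Fin 4 → K) →ₗ[K] (Fin 4 → K) →ₗ[K] (κ → K) :=
    LinearMap.mk₂ K (fun b y => fun r => t r (0, b) (y, 0))
      (fun b b' y => by
        funext r
        have : (((0 : Fin 4 → K), b + b') : (Fin 4 → K) × (Fin 4 → K)) = (0, b) + (0, b') := by simp
        simp only [Pi.add_apply, this, map_add, LinearMap.add_apply])
      (fun s b y => by
        funext r
        have : (((0 : Fin 4 → K), s • b) : (Fin 4 → K) × (Fin 4 → K)) = s • (0, b) := by simp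
        simp only [Pi.smul_apply, this, map_smul, LinearMap.smul_apply, smul_eq_mul])
      (fun b y y' => by
        funext r
        have : ((y + y', (0 : Fin 4 → K)) : (Fin 4 → K) × (Fin 4 → K)) = (y, 0) + (y', 0) := by simp
        simp only [Pi.add_apply, this, map_add])
      (fun s b y => by
        funext r
        have : ((s • y, (0 : Fin 4 → K)) : (Fin 4 → K) × (Fin 4 → K)) = s • (y, 0) := by simp
        simp only [Pi.smul_apply, this, map_smul, smul_eq_mul])
  have hνap : ∀ b y r, ν b y r = t r (0, b) (y, 0) := fun b y r => rfl
  let m : Fin 4 → κ → K := fun l r => t r (one, 0) (0, Pi.single l 1)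
  -- the reduced identity and its bidegree pieces
  have hred := reduced_identity_of_scalar c t hJ v₀ v₀' hv₀ hv₀'
  have hνiso : ∀ b y, ∑ r, c r * ν b y r * ν b y r = 0 := by
    intro b y
    have h := hred 0 b y 0
    simp only [t00, t00', add_zero, mul_zero, Finset.sum_const_zero, sub_zero,
      per_zero_row₀] at h
    rw [← h]
    exact Finset.sum_congr rfl fun r _ => by rw [hνap]; ring
  have hμiso : ∀ a z, ∑ r, c r * t r (a, 0) (0, z) * t r (a, 0) (0, z) = 0 := by
    intro a z
    have h := hred a 0 0 z
    simp only [t00, t00', zero_add, mul_zero, Finset.sum_const_zero, sub_zero,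
      per_zero_row₂] at h
    rw [← h]
    exact Finset.sum_congr rfl fun r _ => by ring
  have hm : ∀ l l', ∑ r, c r * m l r * m l' r = 0 := by
    intro l l'
    refine wdot_eq_zero_of_isotropic c (m l) (m l') (hμiso _ _) (hμiso _ _) ?_
    have : m l + m l' = fun r => t r (one, 0) (0, Pi.single l 1 + Pi.single l' 1) := by
      funext r
      have e : (((0 : Fin 4 → K), Pi.single l (1 : K) + Pi.single l' 1) : (Fin 4 → K) × (Fin 4 → K))
          = (0, Pi.single l 1) + (0, Pi.single l' 1) := by simp
      simp only [m, Pi.add_apply, e, map_add]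
    rw [this]; exact hμiso _ _
  have hX : ∀ a b y z, 2 * ∑ r, c r * ν b y r * t r (a, 0) (0, z) =
      (Matrix.of ![a, b, y, z]).permanent - 2 * ∑ r, c r * t r (a, 0) (y, 0) * t r (0, b) (0, z) := by
    intro a b y z
    have h := hred a b y z
    have e : ∑ r, c r * (t r (0, b) (y, 0) + t r (a, 0) (0, z)) ^ 2 =
        ∑ r, c r * ν b y r * ν b y r + ∑ r, c r * t r (a, 0) (0, z) * t r (a, 0) (0, z) +
          2 * ∑ r, c r * ν b y r * t r (a, 0) (0, z) := by
      rw [Finset.mul_sum, ← Finset.sum_add_distrib, ← Finset.sum_add_distrib]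
      exact Finset.sum_congr rfl fun r _ => by rw [hνap]; ring
    rw [e, hνiso, hμiso, zero_add, zero_add] at h
    exact h
  -- symmetry `b ↔ l` of `per(𝟙; e_b; y; e_l)`
  have per_sym : ∀ (u v w x : Fin 4 → K),
      (Matrix.of ![u, v, w, x]).permanent = (Matrix.of ![u, x, w, v]).permanent :=
    fun u v w x => by simp only [permanent_of_rows]; ring
  -- apply the Lagrangian confinement
  have hconf := lagrangian_confinement c hc hκ ν hνiso m hm v₀ v₀'
    (fun b y => by rw [wdot_comm]; simpa only [hνap] using hB₂ b y)
    (fun b y => by rw [wdot_comm]; simpa only [hνap] using hB₂' b y)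
    (fun l => by rw [wdot_comm]; exact hA₃ one (Pi.single l 1))
    (fun l => by rw [wdot_comm]; exact hA₃' one (Pi.single l 1))
    (by rw [← hQ]; exact Finset.sum_congr rfl fun r _ => by ring)
    (by rw [← hQ']; exact Finset.sum_congr rfl fun r _ => by ring)
    hlam y₀ y₁ P₀ P₁
    (fun b l => by
      rw [hP₀, hX, show ∑ r, c r * t r (one, 0) (y₀, 0) * t r (0, Pi.single b 1) (0, Pi.single l 1)
        = 0 from Finset.sum_eq_zero fun r _ => by rw [hy₀ r]; ring]
      ring)
    (fun b l => by
      rw [hP₁, hX, show ∑ r, c r * t r (one, 0) (y₁, 0) * t r (0, Pi.single b 1) (0, Pi.single l 1)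
        = 0 from Finset.sum_eq_zero fun r _ => by rw [hy₁ r]; ring]
      ring)
    (by ext b l; rw [transpose_apply, hP₀, hP₀]; exact per_sym _ _ _ _)
    (by ext b l; rw [transpose_apply, hP₁, hP₁]; exact per_sym _ _ _ _)
    hdet htz
  -- conclusion
  intro a b y z
  have hcoef : (fun l => (Matrix.of ![one, b, y, Pi.single l 1]).permanent
      - 2 * ∑ r, c r * t r (one, 0) (y, 0) * t r (0, b) (0, Pi.single l 1)) =
      fun l => 2 * ∑ r, c r * ν b y r * m l r := by
    funext l; rw [hX]
  rw [← hX a b y z, hconf b y, hcoef]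
  rw [wdot_sum_smul_left]
  refine Finset.mul_sum _ _ _ |>.trans ?_
  refine Finset.sum_congr rfl fun b' _ => ?_
  rw [← hX a (Pi.single b' 1) y₀ z]
  ring

end Summit.ValiantsHypothesis.ValiantsHypothesis.Theorems.SymPencilPerFourPeeledFactor

end
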